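import Literature.MathematicalPhysics.QuantumFieldTheory.LatticeLangevinDynamics
import Literature.MathematicalPhysics.QuantumLattice.RepLieAlgebraUnitary
import Summits.QuantumFields.YangMills.Theorems.ColdStartUniversalityColdStartSolutionsExistQuaternion
import Summits.QuantumFields.YangMills.Theorems.ColdStartUniversalityColdStartSolutionsExistSpanRange
import HarnessLib

/-!
# Route `ColdStartUniversality`, crux K_A1 `UniformColdStartMixing` (stmt-QuantumFields-24809), rung `stub_fixedCutoffMixing`:
# `SU(2)` algebra for the latitude (ridge-function) calculus of the `β' = 0` lattice Langevin dynamics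

Helper file (seat `ym-line-csu-p1`, g7).  The `β' = 0` SZZ dynamics is Brownian motion on `SU(2)^E`; its coordinate
generator (the integrand of `dynkin_expectation_szz`) acts on a *ridge function* `Q ↦ F(⟨G, Q_e⟩)`,
`⟨X, Y⟩ = ½ Re tr(X Yᴴ) = ½ hsForm 2 X Y` (the Euclidean inner product of `ℝ⁴ ≅ ℍ ⊇ SU(2) = S³`), as the Jacobi
operator `½[(1 - s²) F'' - 3 s F']` — the radial part of `½ Δ_{S³}`.  This file supplies the finite-dimensional
algebra behind that computation:

* `hsForm_lieProj_comm` — `𝐩` is `hsForm`-symmetric; `sum_hsForm_noiseDir_sq` — Parseval `Σₙ ⟨X, Eₙ⟩² = ⟨X, X⟩`;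
  `sum_hsForm_lieProj_noiseDir_sq` — `Σₙ ⟨Y, 𝐩 Eₙ⟩² = ⟨𝐩 Y, 𝐩 Y⟩` (any lattice representation);
* for the fundamental representation of `SU(2)`: `lieProj_rho_two` — `𝐩 ρ(k) = ρ(k) - (Re tr ρ(k) / 2) 1` (a unit
  quaternion minus its real part), `hsForm_lieProj_rho_two` — `‖𝐩 ρ(k)‖² = 2 (1 - s²)`, and the noise covariance on a
  ridge coordinate `sum_hsForm_lieProj_noiseDir_mul_sq` — `Σₙ ⟨ρ(g), 𝐩(Eₙ) ρ(u)⟩² = 2 (1 - s²)`, `s = ⟨ρ g, ρ u⟩ / 2`.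

The Casimir `C_{𝔰𝔲(2)} = -(3/2) 1` (the drift of the `β' = 0` dynamics) is in the sibling file `…LatticeLangevinCasimirTwo`.
No definition, no sorry.  RECORD-rung R3 plumbing; nothing here bears on the mass gap.
-/

set_option autoImplicit false

noncomputable section

namespace Summit.QuantumFields.YangMills.Theorems.ColdStartUniversality

open Matrix Complex Finset
open scoped ComplexConjugate BigOperators
open Literature.MathematicalPhysics.QuantumFieldTheory
open Literature.MathematicalPhysics.QuantumLattice (fundamentalRep fundamentalLatticeRep
  mem_oneParamGenerators_specialUnitaryGroup trace_re_eq_zero_of_star_eq_neg)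

/-! ### Generic: symmetry of `𝐩`, Parseval -/

section Generic

variable {G : Type*} [Group G] [TopologicalSpace G] (r : LatticeRep G)

/-- `⟨𝐩 X, Y⟩ = ⟨𝐩 X, 𝐩 Y⟩`: the component of `Y` orthogonal to `𝔤` is not seen by `𝐩 X ∈ 𝔤`. [folklore] -/
theorem hsForm_lieProj_left_eq (X Y : Matrix (Fin r.N) (Fin r.N) ℂ) :
    hsForm r.N (r.lieProj X) Y = hsForm r.N (r.lieProj X) (r.lieProj Y) := by
  have h := r.hsForm_sub_lieProj (X := Y) (r.lieProj_mem X)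
  rw [map_sub, sub_eq_zero] at h
  exact h

/-- **`𝐩` is symmetric for `Re tr(X Yᴴ)`**: `⟨𝐩 X, Y⟩ = ⟨X, 𝐩 Y⟩` (orthogonal projection). [folklore] -/
theorem hsForm_lieProj_comm (X Y : Matrix (Fin r.N) (Fin r.N) ℂ) :
    hsForm r.N (r.lieProj X) Y = hsForm r.N X (r.lieProj Y) := by
  rw [hsForm_lieProj_left_eq, hsForm_comm (r.lieProj X), ← hsForm_lieProj_left_eq, hsForm_comm]

/-- **Parseval** for the canonical orthonormal basis `(Eₙ)` of `(M_N(ℂ), Re tr(X Yᴴ))`, polarised: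
`Σₙ ⟨X, Eₙ⟩ ⟨Y, Eₙ⟩ = ⟨X, Y⟩`. [folklore] -/
theorem sum_hsForm_noiseDir_mul {N : ℕ} (X Y : Matrix (Fin N) (Fin N) ℂ) :
    ∑ n : NoiseIdx N, hsForm N X (noiseDir n) * hsForm N Y (noiseDir n) = hsForm N X Y := by
  conv_rhs => rw [← sum_hsForm_noiseDir_smul Y]
  rw [map_sum]
  refine Finset.sum_congr rfl fun n _ => ?_
  rw [map_smul, smul_eq_mul, mul_comm]

/-- **Parseval**: `Σₙ ⟨X, Eₙ⟩² = ⟨X, X⟩`. [folklore] -/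
theorem sum_hsForm_noiseDir_sq {N : ℕ} (X : Matrix (Fin N) (Fin N) ℂ) :
    ∑ n : NoiseIdx N, hsForm N X (noiseDir n) ^ 2 = hsForm N X X := by
  simpa [sq] using sum_hsForm_noiseDir_mul X X

/-- `Σₙ ⟨Y, 𝐩 Eₙ⟩² = ⟨𝐩 Y, 𝐩 Y⟩` (symmetry of `𝐩` and Parseval). [folklore] -/
theorem sum_hsForm_lieProj_noiseDir_sq (Y : Matrix (Fin r.N) (Fin r.N) ℂ) :
    ∑ n : NoiseIdx r.N, hsForm r.N Y (r.lieProj (noiseDir n)) ^ 2 =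
      hsForm r.N (r.lieProj Y) (r.lieProj Y) := by
  have h : ∀ n, hsForm r.N Y (r.lieProj (noiseDir n)) = hsForm r.N (r.lieProj Y) (noiseDir n) := fun n => by
    rw [← hsForm_lieProj_comm]
  simp_rw [h, sum_hsForm_noiseDir_sq]

/-- A real multiple of the identity is `hsForm`-orthogonal to `𝔤` (elements of `𝔤` are skew-Hermitian, so
`Re tr = 0`). [folklore] -/
theorem smul_one_mem_orthogonal_lieAlg (s : ℝ) :
    ((s : ℂ) • (1 : Matrix (Fin r.N) (Fin r.N) ℂ)) ∈ (hsForm r.N).orthogonal r.lieAlg := by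
  rw [LinearMap.BilinForm.mem_orthogonal_iff]
  intro Y hY
  change hsForm r.N Y ((s : ℂ) • 1) = 0
  rw [hsForm_apply, Matrix.conjTranspose_smul, Matrix.conjTranspose_one, Matrix.mul_smul, Matrix.mul_one,
    Matrix.trace_smul, Complex.star_def, Complex.conj_ofReal, smul_eq_mul, Complex.mul_re, Complex.ofReal_re,
    Complex.ofReal_im, zero_mul, sub_zero, trace_re_eq_zero_of_star_eq_neg (r.star_eq_neg_of_mem_lieAlg hY),
    mul_zero]

/-- `𝐩 (s • 1) = 0` for real `s`. [folklore] -/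
theorem lieProj_smul_one (s : ℝ) : r.lieProj ((s : ℂ) • (1 : Matrix (Fin r.N) (Fin r.N) ℂ)) = 0 :=
  Submodule.projection_apply_of_mem_right _ (smul_one_mem_orthogonal_lieAlg r s)

end Generic

/-! ### The fundamental representation of `SU(2)`: projection of a unit quaternion, the Casimir -/

section SU2


/-! #### Layer 1: concrete `2 × 2` facts (quaternion structure of `SU(2)`) -/

/-- `ρ(k) + ρ(k)ᴴ = (Re tr ρ(k)) • 1` for `k ∈ SU(2)` (quaternion structure `[[z, w], [-w̄, z̄]]`). [folklore] -/
theorem fundamentalRep_add_conjTranspose (k : Matrix.specialUnitaryGroup (Fin 2) ℂ) :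
    (fundamentalRep (Fin 2) k : Matrix (Fin 2) (Fin 2) ℂ) + (fundamentalRep (Fin 2) k)ᴴ =
      (((fundamentalRep (Fin 2) k : Matrix (Fin 2) (Fin 2) ℂ).trace.re : ℝ) : ℂ) • (1 : Matrix (Fin 2) (Fin 2) ℂ) := by
  set A : Matrix (Fin 2) (Fin 2) ℂ := fundamentalRep (Fin 2) k with hA
  have hk : A ∈ Matrix.specialUnitaryGroup (Fin 2) ℂ := k.2
  have h11 := apply_one_one_eq hk
  have h10 := apply_one_zero_eq hk
  have htr : ((A.trace.re : ℝ) : ℂ) = A 0 0 + conj (A 0 0) := by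
    rw [Matrix.trace_fin_two, h11, Complex.add_conj, Complex.ofReal_re]
  ext i j
  fin_cases i <;> fin_cases j
  · simp [Matrix.conjTranspose_apply, htr]
  · simp [Matrix.conjTranspose_apply, h10]
  · simp [Matrix.conjTranspose_apply, h10]
  · simp only [Matrix.add_apply, Matrix.conjTranspose_apply, Matrix.smul_apply, Matrix.one_apply_eq, htr, h11,
      smul_eq_mul, mul_one, Complex.star_def, Complex.conj_conj, Fin.mk_one, Fin.isValue]
    ring

/-- The trace of an `SU(2)` matrix is real. [folklore] -/
theorem trace_fundamentalRep_eq (k : Matrix.specialUnitaryGroup (Fin 2) ℂ) :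
    (fundamentalRep (Fin 2) k : Matrix (Fin 2) (Fin 2) ℂ).trace = (((fundamentalRep (Fin 2) k : Matrix (Fin 2) (Fin 2)
          ℂ).trace.re : ℝ) : ℂ) := by
  have h11 : (fundamentalRep (Fin 2) k : Matrix (Fin 2) (Fin 2) ℂ) 1 1 = conj ((fundamentalRep (Fin 2) k : Matrix (Fin
        2) (Fin 2) ℂ) 0 0) :=
    apply_one_one_eq k.2
  rw [Matrix.trace_fin_two, h11, Complex.add_conj, Complex.ofReal_re]

/-- `hsForm N X Y = Σᵢⱼ Re (X i j · conj (Y i j))` (entrywise form of `Re tr(X Yᴴ)`). [folklore] -/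
theorem hsForm_eq_sum_entries {N : ℕ} (X Y : Matrix (Fin N) (Fin N) ℂ) :
    hsForm N X Y = ∑ i, ∑ j, (X i j * conj (Y i j)).re := by
  rw [hsForm_apply, Matrix.trace]
  simp only [Matrix.diag_apply, Matrix.mul_apply, Matrix.conjTranspose_apply, Complex.star_def, Complex.re_sum]

/-- `⟨X, 1⟩ = Re tr X`. [folklore] -/
theorem hsForm_one_right {N : ℕ} (X : Matrix (Fin N) (Fin N) ℂ) : hsForm N X 1 = X.trace.re := by
  rw [hsForm_apply, Matrix.conjTranspose_one, Matrix.mul_one]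

/-- `⟨1, 1⟩ = N`. [folklore] -/
theorem hsForm_one_one (N : ℕ) : hsForm N (1 : Matrix (Fin N) (Fin N) ℂ) 1 = N := by
  rw [hsForm_one_right, Matrix.trace_one, Fintype.card_fin]; simp

/-! #### Layer 2: statements about `r₂ = fundamentalLatticeRep 2`

They are phrased in its carrier type `Matrix (Fin r₂.N) (Fin r₂.N) ℂ` (equal to `Matrix (Fin 2) (Fin 2) ℂ` by `rfl`, not
syntactically), the type in which `r₂.lieProj`, `r₂.casimir` and the SZZ coefficient fields live. -/

/-- The range of `(fundamentalLatticeRep 2).ρ` is the set `SU(2)`. [folklore] -/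
theorem range_rho_two : Set.range (fundamentalLatticeRep 2).ρ = (Matrix.specialUnitaryGroup (Fin 2) ℂ : Set (Matrix
      (Fin 2) (Fin 2) ℂ)) :=
  Literature.MathematicalPhysics.QuantumLattice.range_fundamentalLatticeRep 2

/-- A traceless skew-Hermitian matrix lies in the embedded Lie algebra `𝔤` of `fundamentalLatticeRep 2` (it generates a one-parameter
subgroup of `SU(2)`). [folklore] -/
theorem mem_lieAlg_two_of_star_eq_neg {X : Matrix (Fin (fundamentalLatticeRep 2).N) (Fin (fundamentalLatticeRep 2).N)
      ℂ} (hX : star X = -X) (htr : X.trace = 0) : X ∈ (fundamentalLatticeRep 2).lieAlg := by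
  refine (fundamentalLatticeRep 2).lieAlgCarrier_subset_lieAlg ⟨hX, fun t => ?_⟩
  have h := mem_oneParamGenerators_specialUnitaryGroup hX htr t
  rw [range_rho_two]
  exact h

/-- Elements of the embedded Lie algebra of `fundamentalLatticeRep 2` are traceless (`det exp(tX) = 1` for all `t`). [folklore] -/
theorem trace_eq_zero_of_mem_lieAlg_two {X : Matrix (Fin (fundamentalLatticeRep 2).N) (Fin (fundamentalLatticeRep 2).N)
      ℂ} (hX : X ∈ (fundamentalLatticeRep 2).lieAlg) : X.trace = 0 := by
  induction hX using Submodule.span_induction with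
  | mem x hx =>
    refine Literature.MathematicalPhysics.QuantumLattice.trace_eq_zero_of_forall_det_exp_smul_eq_one fun t => ?_
    obtain ⟨g, hg⟩ := hx.2 t
    have hdet : ((fundamentalLatticeRep 2).ρ g).det = 1 := (Matrix.mem_specialUnitaryGroup_iff.1 g.2).2
    rw [hg] at hdet
    exact hdet
  | zero => exact Matrix.trace_zero _ ℂ
  | add x y _ _ hx hy => exact (Matrix.trace_add x y).trans (by rw [hx, hy, add_zero])
  | smul c x _ hx => exact (Matrix.trace_smul c x).trans (by rw [hx, smul_zero])

/-- **`𝐩 ρ(k) = ρ(k) - (Re tr ρ(k) / 2) • 1`** for `k ∈ SU(2)`: the `𝔰𝔲(2)`-projection of a unit quaternion removes its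
real part. [folklore] -/
theorem lieProj_rho_two (k : Matrix.specialUnitaryGroup (Fin 2) ℂ) :
    (fundamentalLatticeRep 2).lieProj ((fundamentalLatticeRep 2).ρ k) = (fundamentalLatticeRep 2).ρ k -
          ((((fundamentalLatticeRep 2).ρ k).trace.re / 2 : ℝ) : ℂ) • (1 : Matrix (Fin (fundamentalLatticeRep 2).N) (Fin
          (fundamentalLatticeRep 2).N) ℂ) := by
  set A : Matrix (Fin (fundamentalLatticeRep 2).N) (Fin (fundamentalLatticeRep 2).N) ℂ := (fundamentalLatticeRep 2).ρ k with hA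
  set s : ℝ := A.trace.re / 2 with hs
  have hadd : A + Aᴴ = ((A.trace.re : ℝ) : ℂ) • (1 : Matrix (Fin (fundamentalLatticeRep 2).N) (Fin
        (fundamentalLatticeRep 2).N) ℂ) := fundamentalRep_add_conjTranspose k
  have htrre : A.trace = ((A.trace.re : ℝ) : ℂ) := trace_fundamentalRep_eq k
  have hmem : (A - ((s : ℝ) : ℂ) • (1 : Matrix (Fin (fundamentalLatticeRep 2).N) (Fin (fundamentalLatticeRep 2).N) ℂ))
        ∈ (fundamentalLatticeRep 2).lieAlg := by
    refine mem_lieAlg_two_of_star_eq_neg ?_ ?_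
    · rw [star_sub, star_smul, star_one, Complex.star_def, Complex.conj_ofReal, Matrix.star_eq_conjTranspose,
        eq_sub_of_add_eq' hadd, hs]
      ext i j
      simp only [Matrix.sub_apply, Matrix.smul_apply, Matrix.neg_apply, smul_eq_mul]
      push_cast
      ring
    · have hN : (((fundamentalLatticeRep 2).N : ℕ) : ℂ) = 2 := by
        simp [Literature.MathematicalPhysics.QuantumLattice.fundamentalLatticeRep_N]
      rw [Matrix.trace_sub, Matrix.trace_smul, Matrix.trace_one, Fintype.card_fin, htrre, hs, smul_eq_mul, hN]
      push_cast
      ring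
  have h1 : (fundamentalLatticeRep 2).lieProj (A - ((s : ℝ) : ℂ) • (1 : Matrix (Fin (fundamentalLatticeRep 2).N) (Fin
        (fundamentalLatticeRep 2).N) ℂ)) = A - ((s : ℝ) : ℂ) • (1 : Matrix (Fin (fundamentalLatticeRep 2).N) (Fin
        (fundamentalLatticeRep 2).N) ℂ) := (fundamentalLatticeRep 2).lieProj_of_mem hmem
  have h2 : (fundamentalLatticeRep 2).lieProj (((s : ℝ) : ℂ) • (1 : Matrix (Fin (fundamentalLatticeRep 2).N) (Fin
        (fundamentalLatticeRep 2).N) ℂ)) = 0 := lieProj_smul_one (fundamentalLatticeRep 2) s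
  have h3 := map_add (fundamentalLatticeRep 2).lieProj (A - ((s : ℝ) : ℂ) • (1 : Matrix (Fin (fundamentalLatticeRep
        2).N) (Fin (fundamentalLatticeRep 2).N) ℂ)) (((s : ℝ) : ℂ) • (1 : Matrix (Fin (fundamentalLatticeRep 2).N) (Fin
        (fundamentalLatticeRep 2).N) ℂ))
  rw [sub_add_cancel, h1, h2, add_zero] at h3
  exact h3

/-- **`‖𝐩 ρ(k)‖² = 2 (1 - s²)`**, `s = Re tr ρ(k) / 2` the latitude of the unit quaternion `ρ(k)` (`‖ρ(k)‖² = 2`,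
`⟨ρ(k), 1⟩ = Re tr ρ(k)`, `‖1‖² = 2`). [folklore] -/
theorem hsForm_lieProj_rho_two (k : Matrix.specialUnitaryGroup (Fin 2) ℂ) :
    hsForm (fundamentalLatticeRep 2).N ((fundamentalLatticeRep 2).lieProj ((fundamentalLatticeRep 2).ρ k))
          ((fundamentalLatticeRep 2).lieProj ((fundamentalLatticeRep 2).ρ k)) =
      2 * (1 - (((fundamentalLatticeRep 2).ρ k).trace.re / 2) ^ 2) := by
  set A : Matrix (Fin (fundamentalLatticeRep 2).N) (Fin (fundamentalLatticeRep 2).N) ℂ := (fundamentalLatticeRep 2).ρ k with hA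
  set s : ℝ := A.trace.re / 2 with hs
  have hproj : (fundamentalLatticeRep 2).lieProj A = A - (((s : ℝ)) : ℂ) • (1 : Matrix (Fin (fundamentalLatticeRep
        2).N) (Fin (fundamentalLatticeRep 2).N) ℂ) := lieProj_rho_two k
  have hAA : hsForm (fundamentalLatticeRep 2).N A A = 2 := hsForm_self_fundamentalRep k
  have hA1 : hsForm (fundamentalLatticeRep 2).N A 1 = 2 * s := by rw [hsForm_one_right, hs]; ring
  have h1A : hsForm (fundamentalLatticeRep 2).N 1 A = 2 * s := by rw [hsForm_comm]; exact hA1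
  have h11 : hsForm (fundamentalLatticeRep 2).N (1 : Matrix (Fin (fundamentalLatticeRep 2).N) (Fin
        (fundamentalLatticeRep 2).N) ℂ) 1 = 2 := by
    rw [hsForm_one_one, Literature.MathematicalPhysics.QuantumLattice.fundamentalLatticeRep_N]; norm_num
  rw [hproj]
  simp only [map_sub, LinearMap.sub_apply, hsForm_coe_smul_right, hsForm_coe_smul_left, hAA, hA1, h1A, h11]
  ring

/-- **Noise covariance on a ridge coordinate**: for `g, u ∈ SU(2)`,
`Σₙ ⟨ρ(g), 𝐩(Eₙ) ρ(u)⟩² = 2 (1 - s²)` with `s = ⟨ρ(g), ρ(u)⟩ / 2 = Re tr(ρ(g) ρ(u)ᴴ) / 2` — the squared norm of the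
tangential part of `ρ(g)` at the point `ρ(u)` of the sphere `S³`. [folklore] -/
theorem sum_hsForm_lieProj_noiseDir_mul_sq (g u : Matrix.specialUnitaryGroup (Fin 2) ℂ) :
    ∑ n : NoiseIdx (fundamentalLatticeRep 2).N, hsForm (fundamentalLatticeRep 2).N ((fundamentalLatticeRep 2).ρ g)
          ((fundamentalLatticeRep 2).lieProj (noiseDir n) * (fundamentalLatticeRep 2).ρ u) ^ 2 =
      2 * (1 - (hsForm (fundamentalLatticeRep 2).N ((fundamentalLatticeRep 2).ρ g) ((fundamentalLatticeRep 2).ρ u) / 2)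
            ^ 2) := by
  -- `⟨G, A U⟩ = ⟨G Uᴴ, A⟩`
  have hmul : ∀ A : Matrix (Fin (fundamentalLatticeRep 2).N) (Fin (fundamentalLatticeRep 2).N) ℂ, hsForm
        (fundamentalLatticeRep 2).N ((fundamentalLatticeRep 2).ρ g) (A * (fundamentalLatticeRep 2).ρ u) = hsForm
        (fundamentalLatticeRep 2).N ((fundamentalLatticeRep 2).ρ g * ((fundamentalLatticeRep 2).ρ u)ᴴ) A := by
    intro A
    rw [hsForm_apply, hsForm_apply, Matrix.conjTranspose_mul, Matrix.mul_assoc]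
  simp_rw [hmul]
  -- `G Uᴴ = ρ(g u⁻¹)`
  have hinv : ((fundamentalLatticeRep 2).ρ u)ᴴ = (fundamentalLatticeRep 2).ρ u⁻¹ := by
    have hu : (fundamentalLatticeRep 2).ρ u * star ((fundamentalLatticeRep 2).ρ u) = 1 := Matrix.mem_unitaryGroup_iff.1
          ((fundamentalLatticeRep 2).mem_unitary u)
    calc ((fundamentalLatticeRep 2).ρ u)ᴴ = (fundamentalLatticeRep 2).ρ (u⁻¹ * u) * star ((fundamentalLatticeRep 2).ρ u) := by
          rw [inv_mul_cancel, map_one, one_mul, Matrix.star_eq_conjTranspose]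
      _ = (fundamentalLatticeRep 2).ρ u⁻¹ := by rw [map_mul, mul_assoc, hu, mul_one]
  have hGU : (fundamentalLatticeRep 2).ρ g * ((fundamentalLatticeRep 2).ρ u)ᴴ = (fundamentalLatticeRep 2).ρ (g * u⁻¹)
        := by rw [hinv, map_mul]
  rw [hGU, sum_hsForm_lieProj_noiseDir_sq, hsForm_lieProj_rho_two]
  -- `Re tr ρ(g u⁻¹) = ⟨ρ g, ρ u⟩`
  have htr : ((fundamentalLatticeRep 2).ρ (g * u⁻¹)).trace.re = hsForm (fundamentalLatticeRep 2).N
        ((fundamentalLatticeRep 2).ρ g) ((fundamentalLatticeRep 2).ρ u) := by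
    rw [hsForm_apply, ← hGU]
  rw [htr]

end SU2

end Summit.QuantumFields.YangMills.Theorems.ColdStartUniversality

end
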